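import Mathlib
import Summits.ValiantsHypothesis.ValiantsHypothesis.Theses.NewtonUnitEquations
import Literature.Computability.AlgebraicComplexity.NewtonPolygonTau
import Summits.ValiantsHypothesis.ValiantsHypothesis.Theorems.NewtonUnitEquationsTwoProductsFormalLogLinearisationDefs
import Summits.ValiantsHypothesis.ValiantsHypothesis.Theorems.NewtonUnitEquationsTwoProductsFormalLogLinearisationSectorDecomposition
import Summits.ValiantsHypothesis.ValiantsHypothesis.Theorems.NewtonUnitEquationsTwoProductsFormalLogLinearisationStubChartNormalisation
import Summits.ValiantsHypothesis.ValiantsHypothesis.Theorems.NewtonUnitEquationsTwoProductsFormalLogLinearisationStubLogLinearisation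
import Summits.ValiantsHypothesis.ValiantsHypothesis.Theorems.NewtonUnitEquationsTwoProductsFormalLogLinearisationStubRaysRung

/-!
# Crux `TwoProducts` (stmt-ValiantsHypothesis-5906), line `formal-log-linearisation`: the reduction to the engine

The registered line `Cruxes/TwoProducts/Lines/formal-log-linearisation.lean` (NOT the item's skeleton of record)
composes five stubs into the crux `TwoProducts` by name (`TwoProducts_of`).  Four of them ("provable now") are now
theorems of the tree over the line's objects (`Theorems/NewtonUnitEquationsTwoProductsFormalLogLinearisationDefs.lean`):

* STUB 1 `stub_sectorDecomposition` (`…FormalLogLinearisationSectorDecomposition.lean`),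
* STUB 2 `stub_chartNormalisation` (`…FormalLogLinearisationStubChartNormalisation.lean`),
* STUB 3 `stub_logLinearisation` (`…FormalLogLinearisationStubLogLinearisation.lean`),
* STUB 4 `stub_raysRung` (`…FormalLogLinearisationStubRaysRung.lean`).

This file lands the line's composition with those four DISCHARGED BY NAME, so that the only remaining hypothesis is
the line's OPEN engine, STUB 5 `stub_logSumEngine` (= `LogSumEngine`, the Transfer `C⁺` of the idea card), stated
here INLINE and VERBATIM as the hypothesis of `twoProducts_of_logSumEngine` (no definition is introduced):

  `LogSumEngine → TwoProducts`, constants `(a + 5, b + 3)` exactly as in the skeleton's `TwoProducts_of`.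

The proof is the skeleton's (kernel-checked there modulo `sorry`s, here sorry-free): for a cancelling top-assignment,
STUB 2 gives tails with `≤ t − 1` monomials and `#hidden ≤ #visible`; if `t ≤ 2` the tails are monomials and STUB 4
bounds the visible points of `supp D` by `2m`, otherwise the ENGINE (at tail sparsity `t − 1 ≥ 2`) bounds them;
STUB 3 transports either bound to the visible set (`visible_ncard_le_of`); STUB 1 turns the uniform bound on hidden
sets into the vertex bound; `bound_arith` closes the arithmetic.

Honest framing: a CONDITIONAL reduction on a registered non-record line.  The engine `LogSumEngine` (all `m`,
`t ≥ 2`, uniform shape `2^{a m}(t+2)^b`) is the line's OPEN core and is NOT claimed; the crux `TwoProducts` stays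
OPEN; nothing here bears on `VP ≠ VNP`.  (The converse `TwoProducts → LogSumEngine` is a separate brick of the
width seat `val-width-0318-p2`.)
-/

set_option linter.dupNamespace false

noncomputable section

open scoped BigOperators
open MvPolynomial Literature.Computability.AlgebraicComplexity

namespace Summit.ValiantsHypothesis.ValiantsHypothesis.Theorems.NewtonUnitEquations.TwoProducts.FormalLogLinearisation

variable {m : ℕ}

/-! ### Glue (the skeleton's, proved) -/

/-- Visible vertices are support points of the normalised difference. [folklore] -/
theorem visible_subset_support (u v : Fin m → MvPolynomial (Fin 2) ℂ) :
    visible u v ⊆ ↑(tailDiff u v).support := by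
  rintro l ⟨ξ, -, hl⟩
  exact hl.1

/-- The visible set of a normalised instance is finite. [folklore] -/
theorem visible_finite (u v : Fin m → MvPolynomial (Fin 2) ℂ) : (visible u v).Finite :=
  (Finset.finite_toSet _).subset (visible_subset_support u v)

/-- IDENTITY ⇒ any bound on finite sets of visible points of `supp D` bounds the visible set of the normalised
difference: by STUB 3 every visible vertex is a visible point of `supp D` (same weight), and the visible set is
finite. [folklore] -/
theorem visible_ncard_le_of {u v : Fin m → MvPolynomial (Fin 2) ℂ} {N : ℕ}
    (hu : ∀ j, coeff 0 (u j) = 0) (hv : ∀ j, coeff 0 (v j) = 0)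
    (hN : ∀ S : Finset Expo, (↑S ⊆ logVisible u v) → S.card ≤ N) :
    (visible u v).ncard ≤ N := by
  classical
  have hfin := visible_finite u v
  rw [Set.ncard_eq_toFinset_card _ hfin]
  refine hN _ ?_
  intro l hl
  have hl' : l ∈ visible u v := by simpa using hl
  obtain ⟨ξ, hξ, htop⟩ := hl'
  exact ⟨ξ, hξ, (stub_logLinearisation m u v hu hv ξ hξ l).1 htop⟩

/-- Arithmetic for the rays branch: `2m ≤ 2^((a+1)m)·(t+2)^(b+1)`. [folklore] -/
theorem two_mul_le_bound (a b m t : ℕ) : 2 * m ≤ 2 ^ ((a + 1) * m) * (t + 2) ^ (b + 1) := by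
  have h1 : m ≤ 2 ^ m := Nat.lt_two_pow_self.le
  have h2 : 2 ^ m ≤ 2 ^ ((a + 1) * m) := Nat.pow_le_pow_right (by norm_num) (by nlinarith)
  have h3 : (2 : ℕ) ≤ (t + 2) ^ (b + 1) :=
    calc (2 : ℕ) = 2 ^ 1 := by norm_num
      _ ≤ 2 ^ (b + 1) := Nat.pow_le_pow_right (by norm_num) (by omega)
      _ ≤ (t + 2) ^ (b + 1) := Nat.pow_le_pow_left (by omega) _
  calc 2 * m ≤ 2 * 2 ^ ((a + 1) * m) := by omega
    _ = 2 ^ ((a + 1) * m) * 2 := by ring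
    _ ≤ 2 ^ ((a + 1) * m) * (t + 2) ^ (b + 1) := Nat.mul_le_mul_left _ h3

/-- Arithmetic for the engine branch (applied at tail-sparsity `t − 1`):
`2^(am)·(t−1+2)^b ≤ 2^((a+1)m)·(t+2)^(b+1)`. [folklore] -/
theorem engine_le_bound (a b m t : ℕ) :
    2 ^ (a * m) * (t - 1 + 2) ^ b ≤ 2 ^ ((a + 1) * m) * (t + 2) ^ (b + 1) := by
  have h1 : 2 ^ (a * m) ≤ 2 ^ ((a + 1) * m) := Nat.pow_le_pow_right (by norm_num) (by nlinarith)
  have h2 : (t - 1 + 2) ^ b ≤ (t + 2) ^ (b + 1) :=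
    calc (t - 1 + 2) ^ b ≤ (t + 2) ^ b := Nat.pow_le_pow_left (by omega) _
      _ ≤ (t + 2) ^ (b + 1) := Nat.pow_le_pow_right (by omega) (by omega)
  exact Nat.mul_le_mul h1 h2

/-- The final arithmetic: `4mt + 2 + 2mt·2^(am)(t+2)^b ≤ 2^((a+4)m)·(t+2)^(b+2)`. [folklore] -/
theorem bound_arith (a b m t : ℕ) :
    4 * m * t + 2 + 2 * m * t * (2 ^ (a * m) * (t + 2) ^ b) ≤ 2 ^ ((a + 4) * m) * (t + 2) ^ (b + 2) := by
  set X : ℕ := 2 ^ (a * m) * (t + 2) ^ b with hX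
  have hX1 : 1 ≤ X := Nat.one_le_iff_ne_zero.2 (by positivity)
  rcases Nat.eq_zero_or_pos m with rfl | hm
  · have h2 : (2 : ℕ) ≤ (t + 2) ^ (b + 2) :=
      calc (2 : ℕ) ≤ 2 ^ (b + 2) := by
            calc (2 : ℕ) = 2 ^ 1 := by norm_num
              _ ≤ 2 ^ (b + 2) := Nat.pow_le_pow_right (by norm_num) (by omega)
        _ ≤ (t + 2) ^ (b + 2) := Nat.pow_le_pow_left (by omega) _
    simpa using h2
  · have h2m : m ≤ 2 ^ m := Nat.lt_two_pow_self.le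
    have ht2 : t ≤ t + 2 := by omega
    have h1t : 1 ≤ t + 2 := by omega
    have h12 : 1 ≤ 2 ^ m := Nat.one_le_two_pow
    have hA : 4 * m * t ≤ 4 * (2 ^ m * (t + 2) * X) := by
      calc 4 * m * t = 4 * (m * t * 1) := by ring
        _ ≤ 4 * (2 ^ m * (t + 2) * X) := by gcongr
    have hB : 2 ≤ 2 * (2 ^ m * (t + 2) * X) := by
      calc 2 = 2 * (1 * 1 * 1) := by ring
        _ ≤ 2 * (2 ^ m * (t + 2) * X) := by gcongr
    have hC : 2 * m * t * X ≤ 2 * (2 ^ m * (t + 2) * X) := by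
      calc 2 * m * t * X = 2 * (m * t * X) := by ring
        _ ≤ 2 * (2 ^ m * (t + 2) * X) := by gcongr
    have hsum : 4 * m * t + 2 + 2 * m * t * X ≤ 8 * (2 ^ m * (t + 2) * X) := by
      calc 4 * m * t + 2 + 2 * m * t * X
          ≤ 4 * (2 ^ m * (t + 2) * X) + 2 * (2 ^ m * (t + 2) * X) + 2 * (2 ^ m * (t + 2) * X) :=
            Nat.add_le_add (Nat.add_le_add hA hB) hC
        _ = 8 * (2 ^ m * (t + 2) * X) := by ring
    have hpow : 2 ^ (m + 3) ≤ 2 ^ (4 * m) := Nat.pow_le_pow_right (by norm_num) (by omega)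
    have hsq : t + 2 ≤ (t + 2) ^ 2 := by nlinarith
    calc 4 * m * t + 2 + 2 * m * t * X ≤ 8 * (2 ^ m * (t + 2) * X) := hsum
      _ = (2 ^ (m + 3) * (t + 2)) * X := by ring
      _ ≤ (2 ^ (4 * m) * (t + 2) ^ 2) * X := by gcongr
      _ = 2 ^ ((a + 4) * m) * (t + 2) ^ (b + 2) := by rw [hX]; ring

/-! ### The reduction: the crux `TwoProducts` from the OPEN engine alone -/

/-- **The line `formal-log-linearisation` closed modulo its engine.**  If the LOG-SUM ENGINE holds — for `t ≥ 2`, any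
finite set of visible points of the support of `D = Σ_j log(1+u_j) − Σ_j log(1+v_j)` (`u_j, v_j` with `≤ t`
monomials and zero constant term, `j < m`) has at most `2^(a·m)·(t+2)^b` elements (the hypothesis is the line's
`LogSumEngine` / registered STUB 5 `stub_logSumEngine` VERBATIM; it is OPEN and NOT claimed here) — then the crux
`TwoProducts` holds, with constants `(a + 5, b + 3)`.  Stubs 1–4 of the line enter as the landed theorems
`stub_sectorDecomposition`, `stub_chartNormalisation`, `stub_logLinearisation`, `stub_raysRung`. [folklore] -/
theorem twoProducts_of_logSumEngine
    (hE : ∃ a b : ℕ, ∀ (m t : ℕ), 2 ≤ t → ∀ (u v : Fin m → MvPolynomial (Fin 2) ℂ),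
      (∀ j, coeff 0 (u j) = 0 ∧ (u j).support.card ≤ t) → (∀ j, coeff 0 (v j) = 0 ∧ (v j).support.card ≤ t) →
        ∀ S : Finset Expo, (↑S ⊆ logVisible u v) → S.card ≤ 2 ^ (a * m) * (t + 2) ^ b) :
    Summit.ValiantsHypothesis.ValiantsHypothesis.Theses.NewtonUnitEquations.TwoProducts := by
  obtain ⟨a, b, hE⟩ := hE
  refine ⟨a + 1 + 4, b + 1 + 2, fun m t f g hf hg => ?_⟩
  have hB : ∀ a' b' : Fin m → Expo, Cancelling f g a' b' →
      (hidden f g a' b').ncard ≤ 2 ^ ((a + 1) * m) * (t + 2) ^ (b + 1) := by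
    intro a' b' hc
    obtain ⟨u, v, hu, hv, hle⟩ := stub_chartNormalisation m t f g hf hg a' b' hc
    refine hle.trans ?_
    by_cases ht : t ≤ 2
    · -- `t ≤ 2`: the tails are monomials — rays rung
      have hu1 : ∀ j, coeff 0 (u j) = 0 ∧ (u j).support.card ≤ 1 :=
        fun j => ⟨(hu j).1, (hu j).2.trans (by omega)⟩
      have hv1 : ∀ j, coeff 0 (v j) = 0 ∧ (v j).support.card ≤ 1 :=
        fun j => ⟨(hv j).1, (hv j).2.trans (by omega)⟩
      exact (visible_ncard_le_of (fun j => (hu j).1) (fun j => (hv j).1) (stub_raysRung m u v hu1 hv1)).trans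
        (two_mul_le_bound a b m t)
    · -- `t ≥ 3`: the engine at tail-sparsity `t − 1 ≥ 2`
      have key := hE m (t - 1) (by omega) u v hu hv
      exact (visible_ncard_le_of (fun j => (hu j).1) (fun j => (hv j).1) key).trans (engine_le_bound a b m t)
  have h := stub_sectorDecomposition m t f g hf hg _ hB
  exact h.trans (bound_arith (a + 1) (b + 1) m t)

end Summit.ValiantsHypothesis.ValiantsHypothesis.Theorems.NewtonUnitEquations.TwoProducts.FormalLogLinearisation

end
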